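import Mathlib.Combinatorics.SimpleGraph.Walk.Counting
import Mathlib.Combinatorics.SimpleGraph.Paths
import Mathlib.Topology.Algebra.InfiniteSum.Constructions
import Mathlib.Topology.Algebra.InfiniteSum.ENNReal
import Summits.CriticalPhenomena.SAWScalingLimit.Theorems.SAWTotalPositivityBoundaryTP2Defs
import HarnessLib

/-!
# Crux `BoundaryTP2` (stmt-CriticalPhenomena-7115), line `Sketch`: the hanging-domino lemma

Helper for the tool stub `stub_strip3_recCorner` (last-column recursion of the kernels of the 3-row
strip into a corner of the new column). Setting: a graph `G` on `V` obtained from a graph `R` by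
hanging a *domino* `m ∼ n` on two vertices `c`, `d`: the fresh vertices `m`, `n` have exactly the
neighbours `N_G(m) = {c, n}`, `N_G(n) = {m, d}`, and `R` is `G` with `m` and `n` deleted
(`R.Adj u v ↔ G.Adj u v ∧ u, v ∉ {m, n}`). A self-avoiding path of `G` between two vertices `a`, `b`
off the domino that visits `m` traverses the whole domino: it contains the segment `d n m c` or the
segment `c m n d` (`s3dom_split`). If every `R`-path `a → c` meets every `R`-path `d → b`
(interlacing), only the first orientation occurs, and cutting the segment out is a bijection onto the
pairs of vertex-disjoint self-avoiding paths `(γ : a → d, γ' : c → b)` of `R`, the length being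
`|γ| + |γ'| + 3`. Hence the **domino identity** (`s3dom_pathKernelOn_visit`)

  `Σ_{γ : a → b in G, m ∈ γ} x^{|γ|} = x³ · Σ_{(γ, γ') disjoint} x^{|γ|} x^{|γ'|}`.

Everything proved; Mathlib only. [folklore]
-/

noncomputable section

namespace Summit.CriticalPhenomena.SAWScalingLimit.Theorems.BoundaryTP2

open scoped ENNReal

variable {V : Type*}

/-! ## Walk lemmas -/

/-- The edges of a walk of a subgraph `R ≤ G` are edges of `G`. [folklore] -/
theorem s3dom_edges_of_le {R G : SimpleGraph V} (hle : R ≤ G) {u v : V} (p : R.Walk u v) :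
    ∀ e, e ∈ p.edges → e ∈ G.edgeSet :=
  fun _ he => SimpleGraph.edgeSet_mono hle (p.edges_subset_edgeSet he)

/-- A walk of a graph in which `m` is isolated, issued from a vertex other than `m`, never visits
`m`. [folklore] -/
theorem s3dom_not_mem_support {R : SimpleGraph V} {m : V} (hm : ∀ z, ¬ R.Adj z m) :
    ∀ {u v : V} (p : R.Walk u v), u ≠ m → m ∉ p.support := by
  intro u v p
  induction p with
  | nil =>
    intro hu h
    rw [SimpleGraph.Walk.support_nil, List.mem_singleton] at h
    exact hu h.symm
  | cons h q ih =>
    intro hu hmem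
    rw [SimpleGraph.Walk.support_cons, List.mem_cons] at hmem
    rcases hmem with hmem | hmem
    · exact hu hmem.symm
    · exact ih (fun hv => hm _ (hv ▸ h)) hmem

/-- The edges of a walk of `G` all of whose vertices satisfy `P` are edges of any graph `R`
containing the `P`-internal edges of `G` (after `…BoundaryTP2TwoEdgeCut`). [folklore] -/
private theorem s3dom_edges_of_support {G R : SimpleGraph V} {P : V → Prop}
    (hR : ∀ u v, G.Adj u v → P u → P v → R.Adj u v) {u v : V} (p : G.Walk u v)
    (hp : ∀ z ∈ p.support, P z) : ∀ e, e ∈ p.edges → e ∈ R.edgeSet := by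
  induction p with
  | nil => intro e he; simp at he
  | cons h q ih =>
    intro e he
    rw [SimpleGraph.Walk.edges_cons, List.mem_cons] at he
    rcases he with rfl | he
    · exact (SimpleGraph.mem_edgeSet R).2 (hR _ _ h (hp _ (by simp)) (hp _ (by simp)))
    · exact ih (fun z hz => hp z (by simp [hz])) e he

/-- Unique splitting in front of a vertex: if `p₁ · d₁n · q₁ = p₂ · d₂n · q₂` with `n` neither on
`p₁` nor on `p₂`, the pieces coincide (after `…BoundaryTP2TwoEdgeCut.split_unique`). [folklore] -/
private theorem s3dom_append_inj {G : SimpleGraph V} {n b : V} :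
    ∀ {a d₁ d₂ : V} (p₁ : G.Walk a d₁) (p₂ : G.Walk a d₂) (h₁ : G.Adj d₁ n) (h₂ : G.Adj d₂ n)
      (q₁ q₂ : G.Walk n b), n ∉ p₁.support → n ∉ p₂.support →
      p₁.append (SimpleGraph.Walk.cons h₁ q₁) = p₂.append (SimpleGraph.Walk.cons h₂ q₂) →
      d₁ = d₂ ∧ HEq p₁ p₂ ∧ q₁ = q₂ := by
  intro a d₁ d₂ p₁
  induction p₁ generalizing d₂ with
  | nil =>
    intro p₂ h₁ h₂ q₁ q₂ _ hp₂ heq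
    cases p₂ with
    | nil =>
      simp only [SimpleGraph.Walk.nil_append, SimpleGraph.Walk.cons.injEq, heq_eq_eq,
        true_and] at heq
      exact ⟨rfl, HEq.rfl, heq⟩
    | cons h' r =>
      simp only [SimpleGraph.Walk.nil_append, SimpleGraph.Walk.cons_append,
        SimpleGraph.Walk.cons.injEq] at heq
      obtain ⟨rfl, -⟩ := heq
      rw [SimpleGraph.Walk.support_cons, List.mem_cons, not_or] at hp₂
      exact absurd r.start_mem_support hp₂.2
  | cons h' r ih =>
    intro p₂ h₁ h₂ q₁ q₂ hp₁ hp₂ heq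
    cases p₂ with
    | nil =>
      simp only [SimpleGraph.Walk.nil_append, SimpleGraph.Walk.cons_append,
        SimpleGraph.Walk.cons.injEq] at heq
      obtain ⟨rfl, -⟩ := heq
      rw [SimpleGraph.Walk.support_cons, List.mem_cons, not_or] at hp₁
      exact absurd r.start_mem_support hp₁.2
    | cons h'' r' =>
      simp only [SimpleGraph.Walk.cons_append, SimpleGraph.Walk.cons.injEq] at heq
      obtain ⟨rfl, heq⟩ := heq
      rw [SimpleGraph.Walk.support_cons, List.mem_cons, not_or] at hp₁ hp₂
      obtain ⟨rfl, h3, h4⟩ := ih r' h₁ h₂ q₁ q₂ hp₁.2 hp₂.2 (eq_of_heq heq)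
      refine ⟨rfl, ?_, h4⟩
      rw [eq_of_heq h3]

/-! ## Paths through the domino -/

/-- **Splitting a path through the domino.** In the domino setting (module docstring), a
self-avoiding path of `G` from `u ∉ {m, n}` to `b ∉ {m, n}` visiting `m` is `p · d n m c · q` or
`p · c m n d · q` with `p`, `q` self-avoiding paths of `R`. [folklore] -/
private theorem s3dom_split {G R : SimpleGraph V} {m n c d b : V} (hle : R ≤ G)
    (hRG : ∀ u v, G.Adj u v → u ≠ m → u ≠ n → v ≠ m → v ≠ n → R.Adj u v)
    (hNm : ∀ z, G.Adj m z ↔ z = c ∨ z = n) (hNn : ∀ z, G.Adj n z ↔ z = m ∨ z = d)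
    (hbm : b ≠ m) (hbn : b ≠ n) (hdn : G.Adj d n) (hnm : G.Adj n m) (hmc : G.Adj m c) :
    ∀ {u : V} (w : G.Walk u b), w.IsPath → m ∈ w.support → u ≠ m → u ≠ n →
      (∃ (p : R.Walk u d) (q : R.Walk c b), p.IsPath ∧ q.IsPath ∧
          w = (p.transfer G (s3dom_edges_of_le hle p)).append
            (SimpleGraph.Walk.cons hdn (SimpleGraph.Walk.cons hnm
              (SimpleGraph.Walk.cons hmc (q.transfer G (s3dom_edges_of_le hle q)))))) ∨
      (∃ (p : R.Walk u c) (q : R.Walk d b), p.IsPath ∧ q.IsPath ∧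
          w = (p.transfer G (s3dom_edges_of_le hle p)).append
            (SimpleGraph.Walk.cons hmc.symm (SimpleGraph.Walk.cons hnm.symm
              (SimpleGraph.Walk.cons hdn.symm (q.transfer G (s3dom_edges_of_le hle q)))))) := by
  have hP : ∀ u v, G.Adj u v → (u ≠ m ∧ u ≠ n) → (v ≠ m ∧ v ≠ n) → R.Adj u v :=
    fun u v h hu hv => hRG u v h hu.1 hu.2 hv.1 hv.2
  intro u w
  induction w with
  | nil =>
    intro _ hm hum _
    rw [SimpleGraph.Walk.support_nil, List.mem_singleton] at hm
    exact absurd hm.symm hum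
  | @cons u v _ h w' ih =>
    intro hw hm hum hun
    rw [SimpleGraph.Walk.cons_isPath_iff] at hw
    have hm' : m ∈ w'.support := by
      rw [SimpleGraph.Walk.support_cons, List.mem_cons] at hm
      exact hm.resolve_left (Ne.symm hum)
    by_cases hvn : n = v
    · subst hvn
      -- the first step enters the domino at `n`, so `u = d`, and the path continues `n m c`
      have hud : d = u := (((hNn u).1 h.symm).resolve_left hum).symm
      subst hud
      obtain ⟨v₂, h₂, w'', rfl⟩ := SimpleGraph.Walk.exists_eq_cons_of_ne hbn.symm w'
      obtain ⟨hw', huw'⟩ := hw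
      rw [SimpleGraph.Walk.cons_isPath_iff] at hw'
      obtain ⟨hw'', hnw''⟩ := hw'
      have hv₂ : m = v₂ := by
        rcases (hNn v₂).1 h₂ with h2 | h2
        · exact h2.symm
        · refine absurd ?_ huw'
          rw [SimpleGraph.Walk.support_cons, ← h2]
          exact List.mem_cons_of_mem _ w''.start_mem_support
      subst hv₂
      obtain ⟨v₃, h₃, w''', rfl⟩ := SimpleGraph.Walk.exists_eq_cons_of_ne hbm.symm w''
      rw [SimpleGraph.Walk.cons_isPath_iff] at hw''
      obtain ⟨hw''', hmw'''⟩ := hw''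
      rw [SimpleGraph.Walk.support_cons, List.mem_cons, not_or] at hnw''
      have hv₃ : c = v₃ := by
        rcases (hNm v₃).1 h₃ with h3 | rfl
        · exact h3.symm
        · exact absurd w'''.start_mem_support hnw''.2
      subst hv₃
      have hsupp : ∀ z ∈ w'''.support, z ≠ m ∧ z ≠ n := fun z hz =>
        ⟨fun h => hmw''' (h ▸ hz), fun h => hnw''.2 (h ▸ hz)⟩
      refine Or.inl ⟨SimpleGraph.Walk.nil, w'''.transfer R (s3dom_edges_of_support hP w''' hsupp),
        SimpleGraph.Walk.IsPath.nil, hw'''.transfer _, ?_⟩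
      simp only [SimpleGraph.Walk.transfer, SimpleGraph.Walk.nil_append,
        SimpleGraph.Walk.transfer_transfer, SimpleGraph.Walk.transfer_self]
    · by_cases hvm : m = v
      · subst hvm
        -- the first step enters the domino at `m`, so `u = c`, and the path continues `m n d`
        have huc : c = u := (((hNm u).1 h.symm).resolve_right hun).symm
        subst huc
        obtain ⟨v₂, h₂, w'', rfl⟩ := SimpleGraph.Walk.exists_eq_cons_of_ne hbm.symm w'
        obtain ⟨hw', huw'⟩ := hw
        rw [SimpleGraph.Walk.cons_isPath_iff] at hw'
        obtain ⟨hw'', hmw''⟩ := hw'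
        have hv₂ : n = v₂ := by
          rcases (hNm v₂).1 h₂ with h2 | h2
          · refine absurd ?_ huw'
            rw [SimpleGraph.Walk.support_cons, ← h2]
            exact List.mem_cons_of_mem _ w''.start_mem_support
          · exact h2.symm
        subst hv₂
        obtain ⟨v₃, h₃, w''', rfl⟩ := SimpleGraph.Walk.exists_eq_cons_of_ne hbn.symm w''
        rw [SimpleGraph.Walk.cons_isPath_iff] at hw''
        obtain ⟨hw''', hnw'''⟩ := hw''
        rw [SimpleGraph.Walk.support_cons, List.mem_cons, not_or] at hmw''
        have hv₃ : d = v₃ := by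
          rcases (hNn v₃).1 h₃ with rfl | h3
          · exact absurd w'''.start_mem_support hmw''.2
          · exact h3.symm
        subst hv₃
        have hsupp : ∀ z ∈ w'''.support, z ≠ m ∧ z ≠ n := fun z hz =>
          ⟨fun h => hmw''.2 (h ▸ hz), fun h => hnw''' (h ▸ hz)⟩
        refine Or.inr ⟨SimpleGraph.Walk.nil, w'''.transfer R (s3dom_edges_of_support hP w''' hsupp),
          SimpleGraph.Walk.IsPath.nil, hw'''.transfer _, ?_⟩
        simp only [SimpleGraph.Walk.transfer, SimpleGraph.Walk.nil_append,
          SimpleGraph.Walk.transfer_transfer, SimpleGraph.Walk.transfer_self]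
      · -- the first edge avoids the domino: it is an edge of `R`; split the tail
        have huv : R.Adj u v := hRG u v h hum hun (Ne.symm hvm) (Ne.symm hvn)
        rcases ih hbm hbn hw.1 hm' (Ne.symm hvm) (Ne.symm hvn) with ⟨p, q, hp, hq, hw'⟩ | ⟨p, q, hp, hq, hw'⟩
        · refine Or.inl ⟨SimpleGraph.Walk.cons huv p, q, ?_, hq, ?_⟩
          · rw [SimpleGraph.Walk.cons_isPath_iff]
            refine ⟨hp, fun hup => hw.2 ?_⟩
            rw [hw', SimpleGraph.Walk.support_append, SimpleGraph.Walk.support_transfer]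
            exact List.mem_append_left _ hup
          · rw [hw']
            rfl
        · refine Or.inr ⟨SimpleGraph.Walk.cons huv p, q, ?_, hq, ?_⟩
          · rw [SimpleGraph.Walk.cons_isPath_iff]
            refine ⟨hp, fun hup => hw.2 ?_⟩
            rw [hw', SimpleGraph.Walk.support_append, SimpleGraph.Walk.support_transfer]
            exact List.mem_append_left _ hup
          · rw [hw']
            rfl

/-! ## The domino identity -/

open Classical in
/-- **The hanging-domino identity.** In the domino setting (`N_G(m) = {c, n}`, `N_G(n) = {m, d}`,
`R = G - m - n`), for `a, b` off the domino such that every `R`-path `a → c` meets every `R`-path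
`d → b`, the self-avoiding paths `a → b` of `G` through `m` are exactly the `γ · d n m c · γ'` for the
vertex-disjoint pairs of self-avoiding paths `(γ : a → d, γ' : c → b)` of `R`, whence
`Σ_{γ ∋ m} x^{|γ|} = x³ · Σ_{(γ, γ') disjoint} x^{|γ|} x^{|γ'|}` (`0 ≤ x`). [folklore] -/
theorem s3dom_pathKernelOn_visit {V : Type*} (G R : SimpleGraph V) (x : ℝ) (hx : 0 ≤ x) {a b c d m n : V}
    (hR : ∀ u v, R.Adj u v ↔ G.Adj u v ∧ (u ≠ m ∧ u ≠ n) ∧ (v ≠ m ∧ v ≠ n))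
    (hNm : ∀ z, G.Adj m z ↔ z = c ∨ z = n) (hNn : ∀ z, G.Adj n z ↔ z = m ∨ z = d)
    (ham : a ≠ m) (han : a ≠ n) (hbm : b ≠ m) (hbn : b ≠ n) (hcn : c ≠ n)
    (hI : Interlaced R a d c b) :
    pathKernelOn G x a b {γ | m ∈ γ.1.support} =
      ENNReal.ofReal (x ^ 3) *
        ∑' (γ : R.Path a d) (γ' : R.Path c b),
          (if List.Disjoint γ.1.support γ'.1.support then
            ENNReal.ofReal (x ^ γ.1.length) * ENNReal.ofReal (x ^ γ'.1.length) else 0) := by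
  -- the setting
  have hle : R ≤ G := fun u v h => ((hR u v).1 h).1
  have hRG : ∀ u v, G.Adj u v → u ≠ m → u ≠ n → v ≠ m → v ≠ n → R.Adj u v :=
    fun u v h h1 h2 h3 h4 => (hR u v).2 ⟨h, ⟨h1, h2⟩, ⟨h3, h4⟩⟩
  have hmc : G.Adj m c := (hNm c).2 (Or.inl rfl)
  have hnm : G.Adj n m := ((hNm n).2 (Or.inr rfl)).symm
  have hdn : G.Adj d n := ((hNn d).2 (Or.inr rfl)).symm
  have hRm : ∀ z, ¬ R.Adj z m := fun z h => ((hR z m).1 h).2.2.1 rfl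
  have hRn : ∀ z, ¬ R.Adj z n := fun z h => ((hR z n).1 h).2.2.2 rfl
  -- the visiting paths, the disjoint pairs and the gluing map
  set S : Set (G.Path a b) := {γ | m ∈ γ.1.support} with hS
  set DP : Set (R.Path a d × R.Path c b) :=
    {q | List.Disjoint q.1.1.support q.2.1.support} with hDP
  have hglue : ∀ q : R.Path a d × R.Path c b, q ∈ DP →
      ((q.1.1.transfer G (s3dom_edges_of_le hle q.1.1)).append
        (SimpleGraph.Walk.cons hdn (SimpleGraph.Walk.cons hnm
          (SimpleGraph.Walk.cons hmc (q.2.1.transfer G (s3dom_edges_of_le hle q.2.1)))))).IsPath := by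
    rintro ⟨γ, γ'⟩ hq
    simp only [hDP, Set.mem_setOf_eq] at hq
    rw [SimpleGraph.Walk.isPath_def, SimpleGraph.Walk.support_append, SimpleGraph.Walk.support_cons,
      List.tail_cons, SimpleGraph.Walk.support_cons, SimpleGraph.Walk.support_cons,
      SimpleGraph.Walk.support_transfer, SimpleGraph.Walk.support_transfer]
    refine List.nodup_append'.2 ⟨γ.2.support_nodup, ?_, ?_⟩
    · refine List.nodup_cons.2 ⟨?_, List.nodup_cons.2
        ⟨s3dom_not_mem_support hRm γ'.1 hmc.ne.symm, γ'.2.support_nodup⟩⟩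
      rw [List.mem_cons, not_or]
      exact ⟨hnm.ne, s3dom_not_mem_support hRn γ'.1 hcn⟩
    · intro z hz hz'
      rw [List.mem_cons, List.mem_cons] at hz'
      rcases hz' with h | h | hz'
      · exact s3dom_not_mem_support hRn γ.1 han (h ▸ hz)
      · exact s3dom_not_mem_support hRm γ.1 ham (h ▸ hz)
      · exact hq hz hz'
  let Φ : DP → G.Path a b := fun q => ⟨_, hglue q.1 q.2⟩
  have hΦ : ∀ q, (Φ q).1 = (q.1.1.1.transfer G (s3dom_edges_of_le hle q.1.1.1)).append
      (SimpleGraph.Walk.cons hdn (SimpleGraph.Walk.cons hnm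
        (SimpleGraph.Walk.cons hmc (q.1.2.1.transfer G (s3dom_edges_of_le hle q.1.2.1))))) :=
    fun q => rfl
  -- gluing is injective
  have hinj : Function.Injective Φ := by
    rintro ⟨⟨γ₁, γ₁'⟩, h₁⟩ ⟨⟨γ₂, γ₂'⟩, h₂⟩ h
    have h' := congrArg Subtype.val h
    rw [hΦ, hΦ] at h'
    obtain ⟨-, hp, hq⟩ := s3dom_append_inj _ _ _ _ _ _
      (by rw [SimpleGraph.Walk.support_transfer]; exact s3dom_not_mem_support hRn γ₁.1 han)
      (by rw [SimpleGraph.Walk.support_transfer]; exact s3dom_not_mem_support hRn γ₂.1 han) h'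
    have hp' := congrArg SimpleGraph.Walk.edges (eq_of_heq hp)
    simp only [SimpleGraph.Walk.cons.injEq, heq_eq_eq, true_and] at hq
    have hq' := congrArg SimpleGraph.Walk.edges hq
    simp only [SimpleGraph.Walk.edges_transfer] at hp' hq'
    have e₁ : γ₁ = γ₂ := Subtype.ext (SimpleGraph.Walk.edges_injective hp')
    have e₂ : γ₁' = γ₂' := Subtype.ext (SimpleGraph.Walk.edges_injective hq')
    subst e₁ e₂
    rfl
  -- gluing reaches every visiting path (the orientation `c m n d` is excluded by interlacing)
  have hrange : Function.support (S.indicator fun γ : G.Path a b => ENNReal.ofReal (x ^ γ.1.length)) ⊆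
      Set.range Φ := by
    intro γ hγ
    have hmem : γ ∈ S := by
      by_contra h
      exact hγ (Set.indicator_of_notMem h _)
    rcases s3dom_split hle hRG hNm hNn hbm hbn hdn hnm hmc γ.1 γ.2 hmem ham han with
      ⟨p, q, hp, hq, hγ'⟩ | ⟨p, q, hp, hq, hγ'⟩
    · have hnd := γ.2
      rw [SimpleGraph.Walk.isPath_def, hγ', SimpleGraph.Walk.support_append,
        SimpleGraph.Walk.support_cons, List.tail_cons, SimpleGraph.Walk.support_cons,
        SimpleGraph.Walk.support_cons, SimpleGraph.Walk.support_transfer,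
        SimpleGraph.Walk.support_transfer] at hnd
      have hdisj : List.Disjoint p.support q.support := fun z hz hz' =>
        List.disjoint_of_nodup_append hnd hz (List.mem_cons_of_mem _ (List.mem_cons_of_mem _ hz'))
      exact ⟨⟨(⟨p, hp⟩, ⟨q, hq⟩), hdisj⟩, Subtype.ext hγ'.symm⟩
    · exfalso
      obtain ⟨v, hvp, hvq⟩ := hI ⟨p, hp⟩ ⟨q, hq⟩
      have hnd := γ.2
      rw [SimpleGraph.Walk.isPath_def, hγ', SimpleGraph.Walk.support_append,
        SimpleGraph.Walk.support_cons, List.tail_cons, SimpleGraph.Walk.support_cons,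
        SimpleGraph.Walk.support_cons, SimpleGraph.Walk.support_transfer,
        SimpleGraph.Walk.support_transfer] at hnd
      exact List.disjoint_of_nodup_append hnd hvp
        (List.mem_cons_of_mem _ (List.mem_cons_of_mem _ hvq))
  -- every glued path visits `m` and has length `|γ| + |γ'| + 3`
  have hmemS : ∀ q, Φ q ∈ S := fun q => by
    rw [hS, Set.mem_setOf_eq, hΦ, SimpleGraph.Walk.support_append, List.mem_append]
    refine Or.inr ?_
    rw [SimpleGraph.Walk.support_cons, List.tail_cons, SimpleGraph.Walk.support_cons]
    exact List.mem_cons_of_mem _ List.mem_cons_self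
  have hlen : ∀ q, (Φ q).1.length = 3 + (q.1.1.1.length + q.1.2.1.length) := fun q => by
    rw [hΦ, SimpleGraph.Walk.length_append, SimpleGraph.Walk.length_cons,
      SimpleGraph.Walk.length_cons, SimpleGraph.Walk.length_cons, SimpleGraph.Walk.length_transfer,
      SimpleGraph.Walk.length_transfer]
    omega
  -- change of variables
  calc pathKernelOn G x a b S
      = ∑' q : DP, S.indicator (fun γ : G.Path a b => ENNReal.ofReal (x ^ γ.1.length)) (Φ q) :=
        (hinj.tsum_eq hrange).symm
    _ = ∑' q : DP, ENNReal.ofReal (x ^ 3) *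
          (ENNReal.ofReal (x ^ q.1.1.1.length) * ENNReal.ofReal (x ^ q.1.2.1.length)) := by
        refine tsum_congr fun q => ?_
        rw [Set.indicator_of_mem (hmemS q), hlen q, pow_add, pow_add,
          ENNReal.ofReal_mul (pow_nonneg hx _), ENNReal.ofReal_mul (pow_nonneg hx _)]
    _ = ENNReal.ofReal (x ^ 3) * ∑' q : DP,
          ENNReal.ofReal (x ^ q.1.1.1.length) * ENNReal.ofReal (x ^ q.1.2.1.length) :=
        ENNReal.tsum_mul_left
    _ = ENNReal.ofReal (x ^ 3) * ∑' q : R.Path a d × R.Path c b,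
          DP.indicator (fun q => ENNReal.ofReal (x ^ q.1.1.length) *
            ENNReal.ofReal (x ^ q.2.1.length)) q := by
        rw [tsum_subtype DP (fun q : R.Path a d × R.Path c b =>
          ENNReal.ofReal (x ^ q.1.1.length) * ENNReal.ofReal (x ^ q.2.1.length))]
    _ = _ := by
        rw [ENNReal.tsum_prod']
        congr 1

end Summit.CriticalPhenomena.SAWScalingLimit.Theorems.BoundaryTP2
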